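import Mathlib
import HarnessLib
import HarnessLib.Audit
import Summits.ResolutionOfSingularities.ResolutionOfSingularities.Theses.WeightedInvariant
import Literature.AlgebraicGeometry.Resolution.CobordantChartCoefficients
import Literature.AlgebraicGeometry.Resolution.CobordantGame

/-!
# Crux `LocalWeightedDrop` — line `cone-game-restriction-rank` (second lead's skeleton)

Crux item stmt-ResolutionOfSingularities-8899, route ResolutionOfSingularities/WeightedInvariant.

Composition idea (Włodarczyk arXiv:2203.03090 Thm 4.3.1 cut at its two joints, with the ORDER as first rank
coordinate).  For an honest `(n+1)`-variable `s`-saturated successor `g(s,y)` of `f` at an off-vertex exceptional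
point `c` of the cobordant blow-up, its RESTRICTION to the exceptional divisor `g(0,y)` — here the `s⁰`-slice
`β ↦ coeff (0,β) g`, an `n`-variable germ — is the `s^a`-slice of `fθ(s^w(c+y))`, i.e. the translate
`T_c(in_w fθ)` of the weight-`a` initial form (`slice_eq_coneTranslate`, from `CobordantChart.coeff_subst_chart`):
the exceptional divisor of `B₊` is the weighted normal cone minus its vertex.  Hence a rank of the shape
`(ord, κ)` drops at `g` as soon as

* (slices)  `ord g ≤ ord g(0,·)`, `s ∤ g ↔ g(0,·) ≠ 0`, and `g ∈ 𝔪² ⇒ g(0,·) ∈ 𝔪²`      — `stub_sliceOrder`,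
  `stub_sliceSingular` [S];
* (point blow-up is order-safe)  under the homothety `w = (1,…,1)` every slice has `ord g(0,·) ≤ ord f`
  (`g(0,·) = f_d(c+y)`, a non-zero polynomial of degree `d = ord f`)            — `stub_pointBlowupOrder` [M];
* (CONE–RESTRICTION RANK, the line's transfer `C⁺`)  there is ONE `κ` on germs of all dimensions with
  (R') `κ_{n+1}(g) ≤ κ_n(g(0,·))` whenever `g` is singular, `s ∤ g` and `ord g = ord g(0,·)`, and
  (C') every singular `f` admits EITHER the homothety with a `κ`-drop `κ_n(g(0,·)) < κ_n(f)` at its plateau slices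
  (`ord g(0,·) = ord f`), OR some legal move all of whose singular successors have order-bounded slices
  (`ord g(0,·) ≤ ord f`) with the same `κ`-drop at the plateau ones             — `stub_coneRestrictionRank` [XL].

`LocalWeightedDrop_of` is the lexicographic `(ord f, κ_n f)` induction over the inductive game
`CobordantGame.Won` (`hasRank_iff_allWon`, `hasRank_iff_literal`): a singular successor either has smaller order,
or (sandwich) `ord g = ord g(0,·) = ord f` and then `κ_{n+1} g ≤ κ_n g(0,·) < κ_n f`.

What (R')+(C') is and is not.  It is satisfied in characteristic 0 by the Bierstone–Milman / ATW invariant (order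
first; restriction to a smooth hypersurface through the point does not decrease the invariant; the weighted centre
of the maximal invariant has the pure power `x₁^{a₁}` on its initial face, which gives `ord T_c(in_w f) ≤ a₁`) — this
is the content of Włodarczyk's cobordant drop.  It is NOT satisfied by the least game rank (planner F1: the kangaroo
`x²+y⁷+ys⁴`, `p = 2`, needs two moves while its slice `x²+y⁷` needs one), and `κ` cannot be dropped (order-only
ranks are refuted: cdisprove §E at `x²+y³z²`, triage r1-2 S5 at `x²+y³z³`).  Finding `κ` in characteristic `p` is
the open core (ATW 2024 §1.9 / AQS arXiv:2412.16426 Rem 5.7); the stub is the honest place where it lives.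
-/

set_option linter.dupNamespace false -- `Summit.ResolutionOfSingularities.ResolutionOfSingularities` is the mandated namespace of this single-conjunct summit (lakefile weak option)

namespace Summit.ResolutionOfSingularities.ResolutionOfSingularities.Theorems.ConeRestrictionLine

open Literature.AlgebraicGeometry.Resolution

/-! ## Registered stubs -/

/-- SLICE ORDER.  For `g ∈ k[[s,y₁,…,yₙ]]` and its `s⁰`-slice `g(0,·) = (β ↦ coeff (0,β) g)`:
`ord g ≤ ord g(0,·)`, and `s ∤ g` iff `g(0,·) ≠ 0`. -/
theorem stub_sliceOrder : ∀ (k : Type) [Field k] (n : ℕ) (g : MvPowerSeries (Fin (n + 1)) k),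
    g.order ≤ MvPowerSeries.order
      (show MvPowerSeries (Fin n) k from fun β => MvPowerSeries.coeff (Finsupp.cons 0 β) g) ∧
    (¬ (MvPowerSeries.X (0 : Fin (n + 1)) ∣ g) ↔
      (show MvPowerSeries (Fin n) k from fun β => MvPowerSeries.coeff (Finsupp.cons 0 β) g) ≠ 0) := by
  sorry

/-- SLICE SINGULAR.  If `g ∈ 𝔪²` (no constant and no linear coefficients) then so is its `s⁰`-slice `g(0,·)`. -/
theorem stub_sliceSingular : ∀ (k : Type) [Field k] (n : ℕ) (g : MvPowerSeries (Fin (n + 1)) k),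
    (MvPowerSeries.constantCoeff g = 0 ∧ ∀ j, MvPowerSeries.coeff (Finsupp.single j 1) g = 0) →
    (MvPowerSeries.constantCoeff
        (show MvPowerSeries (Fin n) k from fun β => MvPowerSeries.coeff (Finsupp.cons 0 β) g) = 0 ∧
      ∀ i : Fin n, MvPowerSeries.coeff (Finsupp.single i 1)
        (show MvPowerSeries (Fin n) k from fun β => MvPowerSeries.coeff (Finsupp.cons 0 β) g) = 0) := by
  sorry

/-- POINT BLOW-UP IS ORDER-SAFE.  Under the homothety `w = (1,…,1)` (the cobordant form of the blow-up of the
origin), at every exceptional point `c` (any `c`; the chart needs no convention since all weights are positive) the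
`s⁰`-slice of the `s`-saturated transform `g` of `F ≠ 0` has order at most `ord F`: it is `F_d(c+y)`, the translate
of the degree-`d = ord F` form of `F`, a non-zero polynomial of degree `d`. -/
theorem stub_pointBlowupOrder : ∀ (k : Type) [Field k] (n : ℕ) (F : MvPowerSeries (Fin n) k), F ≠ 0 →
    ∀ (c : Fin n → k) (a : ℕ) (g : MvPowerSeries (Fin (n + 1)) k),
    MvPowerSeries.subst (CobordantChart.chart (fun _ : Fin n => 1) c) F = MvPowerSeries.X 0 ^ a * g →
    ¬ (MvPowerSeries.X (0 : Fin (n + 1)) ∣ g) →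
    MvPowerSeries.order
      (show MvPowerSeries (Fin n) k from fun β => MvPowerSeries.coeff (Finsupp.cons 0 β) g) ≤ F.order := by
  sorry

/-- CONE–RESTRICTION RANK (hardest stub; the line's transfer `C⁺`, Włodarczyk's Thm 4.3.1 scheme in
characteristic `p` with the order split off).  ONE ordinal `κ` on formal germs of all embedding dimensions such that
(R') for a singular `g ∈ k[[s,y]]` with `s ∤ g` and `ord g = ord g(0,·)`, `κ_{n+1}(g) ≤ κ_n(g(0,·))`; and
(C') every singular `f` admits either the homothety `(X, (1,…,1))` with `κ_n(g(0,·)) < κ_n(f)` at every singular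
successor whose slice keeps the order, or some legal move `(θ, w)` at all of whose off-vertex singular successors
the slice has order `≤ ord f`, and `κ_n(g(0,·)) < κ_n(f)` when it has order `= ord f`.  (The slice `g(0,·)` is the
cone translate `T_c(in_w fθ)` — `slice_eq_coneTranslate` — so (C') is a statement about weighted tangent cones in
FIXED dimension `n`.) -/
theorem stub_coneRestrictionRank : ∀ (p : ℕ), p.Prime → ∀ (k : Type) [Field k] [CharP k p] [IsAlgClosed k],
    ∃ κ : (n : ℕ) → MvPowerSeries (Fin n) k → Ordinal.{0},
    (∀ (n : ℕ) (g : MvPowerSeries (Fin (n + 1)) k),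
      (g ≠ 0 ∧ MvPowerSeries.constantCoeff g = 0 ∧ ∀ j, MvPowerSeries.coeff (Finsupp.single j 1) g = 0) →
      ¬ (MvPowerSeries.X (0 : Fin (n + 1)) ∣ g) →
      g.order = MvPowerSeries.order
        (show MvPowerSeries (Fin n) k from fun β => MvPowerSeries.coeff (Finsupp.cons 0 β) g) →
      κ (n + 1) g ≤ κ n (show MvPowerSeries (Fin n) k from fun β => MvPowerSeries.coeff (Finsupp.cons 0 β) g)) ∧
    ∀ (n : ℕ) (f : MvPowerSeries (Fin n) k),
      (f ≠ 0 ∧ MvPowerSeries.constantCoeff f = 0 ∧ ∀ i, MvPowerSeries.coeff (Finsupp.single i 1) f = 0) →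
      (∀ (c : Fin n → k), c ≠ 0 → ∀ (a : ℕ) (g : MvPowerSeries (Fin (n + 1)) k),
          MvPowerSeries.subst (CobordantChart.chart (fun _ : Fin n => 1) c) f = MvPowerSeries.X 0 ^ a * g →
          ¬ (MvPowerSeries.X (0 : Fin (n + 1)) ∣ g) →
          (MvPowerSeries.constantCoeff g = 0 ∧ ∀ j, MvPowerSeries.coeff (Finsupp.single j 1) g = 0) →
          (MvPowerSeries.constantCoeff
              (show MvPowerSeries (Fin n) k from fun β => MvPowerSeries.coeff (Finsupp.cons 0 β) g) = 0 ∧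
            ∀ i : Fin n, MvPowerSeries.coeff (Finsupp.single i 1)
              (show MvPowerSeries (Fin n) k from fun β => MvPowerSeries.coeff (Finsupp.cons 0 β) g) = 0) →
          MvPowerSeries.order
            (show MvPowerSeries (Fin n) k from fun β => MvPowerSeries.coeff (Finsupp.cons 0 β) g) = f.order →
          κ n (show MvPowerSeries (Fin n) k from fun β => MvPowerSeries.coeff (Finsupp.cons 0 β) g) < κ n f) ∨
      (∃ (θ : Fin n → MvPowerSeries (Fin n) k) (w : Fin n → ℕ),
        (∀ i, MvPowerSeries.constantCoeff (θ i) = 0) ∧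
        IsUnit (Matrix.det (Matrix.of fun i j => MvPowerSeries.coeff (Finsupp.single j 1) (θ i))) ∧
        (∃ i, 0 < w i) ∧
        ∀ (c : Fin n → k), (∀ i, w i = 0 → c i = 0) → c ≠ 0 →
        ∀ (a : ℕ) (g : MvPowerSeries (Fin (n + 1)) k),
          MvPowerSeries.subst (CobordantChart.chart w c) (MvPowerSeries.subst θ f) = MvPowerSeries.X 0 ^ a * g →
          ¬ (MvPowerSeries.X (0 : Fin (n + 1)) ∣ g) →
          (MvPowerSeries.constantCoeff g = 0 ∧ ∀ j, MvPowerSeries.coeff (Finsupp.single j 1) g = 0) →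
          (MvPowerSeries.constantCoeff
              (show MvPowerSeries (Fin n) k from fun β => MvPowerSeries.coeff (Finsupp.cons 0 β) g) = 0 ∧
            ∀ i : Fin n, MvPowerSeries.coeff (Finsupp.single i 1)
              (show MvPowerSeries (Fin n) k from fun β => MvPowerSeries.coeff (Finsupp.cons 0 β) g) = 0) →
          MvPowerSeries.order
              (show MvPowerSeries (Fin n) k from fun β => MvPowerSeries.coeff (Finsupp.cons 0 β) g) ≤ f.order ∧
            (MvPowerSeries.order
                (show MvPowerSeries (Fin n) k from fun β => MvPowerSeries.coeff (Finsupp.cons 0 β) g) = f.order →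
              κ n (show MvPowerSeries (Fin n) k from fun β => MvPowerSeries.coeff (Finsupp.cons 0 β) g) < κ n f)) := by
  sorry

/-! ## Sorry-free glue -/

/-- The `s⁰`-slice `g(0,·)` of `g ∈ k[[s, y₁, …, yₙ]]` (`s = X 0`) as an `n`-variable germ: `β ↦ coeff (0,β) g`.
(Notation only — no definition is introduced; it unfolds on the spot.) -/
local notation3 (prettyPrint := false) "slice0 " g:max =>
  (show MvPowerSeries (Fin _) _ from fun β => MvPowerSeries.coeff (Finsupp.cons 0 β) g)


variable {k : Type} [Field k]

/-- In zero variables there is no singular germ (a series in no variables is its constant coefficient). -/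
theorem not_isSingular_zero (f : MvPowerSeries (Fin 0) k) : ¬ CobordantGame.IsSingular k f := by
  rintro ⟨hf, hf0, -⟩
  apply hf
  ext d
  have hd : d = 0 := Subsingleton.elim d 0
  subst hd
  simpa using hf0

/-- The identity substitution with unit weights is a legal move as soon as `n ≠ 0`. -/
theorem isMove_homothety {n : ℕ} (hn : n ≠ 0) :
    CobordantGame.IsMove k (fun i : Fin n => (MvPowerSeries.X i : MvPowerSeries (Fin n) k)) (fun _ => 1) := by
  refine ⟨fun i => MvPowerSeries.constantCoeff_X i, ?_, ?_⟩
  · have h1 : (Matrix.of fun i j : Fin n =>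
        MvPowerSeries.coeff (Finsupp.single j 1) (MvPowerSeries.X i : MvPowerSeries (Fin n) k)) = 1 := by
      ext i j
      rw [Matrix.of_apply, MvPowerSeries.coeff_X, Matrix.one_apply]
      by_cases h : i = j
      · subst h; simp
      · rw [if_neg, if_neg h]
        intro h'
        exact h ((Finsupp.single_left_injective Nat.one_ne_zero) h').symm
    rw [h1, Matrix.det_one]
    exact isUnit_one
  · obtain ⟨i⟩ : Nonempty (Fin n) := Fin.pos_iff_nonempty.mp (Nat.pos_of_ne_zero hn)
    exact ⟨i, Nat.one_pos⟩

/-- A non-zero germ has finite order. -/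
theorem exists_order_eq_nat {σ : Type*} {f : MvPowerSeries σ k} (hf : f ≠ 0) : ∃ d : ℕ, f.order = d :=
  ENat.ne_top_iff_exists.mp (fun h => hf (MvPowerSeries.order_eq_top_iff.mp h)) |>.imp fun _ h => h.symm

/-- THE COMPOSITION: the line closes the crux `LocalWeightedDrop` BY NAME, modulo the registered stubs.
`ι` is the least game value; the winning strategy is read off `stub_coneRestrictionRank` by the lexicographic
`(ord f, κ_n f)` induction, using `stub_sliceOrder` / `stub_sliceSingular` (restriction bookkeeping) and
`stub_pointBlowupOrder` (the homothety branch is order-safe). -/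
theorem LocalWeightedDrop_of :
    Summit.ResolutionOfSingularities.ResolutionOfSingularities.Theses.WeightedInvariant.LocalWeightedDrop := by
  intro p hp k _ _ _
  obtain ⟨κ, hR, hC⟩ := stub_coneRestrictionRank p hp k
  apply (CobordantGame.hasRank_iff_literal (k := k)).mp
  apply (CobordantGame.hasRank_iff_allWon (k := k)).mpr
  -- lexicographic induction on (ord f, κ n f)
  suffices key : ∀ (d : ℕ) (α : Ordinal.{0}) (n : ℕ) (f : MvPowerSeries (Fin n) k),
      CobordantGame.IsSingular k f → f.order = d → κ n f = α → CobordantGame.Won k n f by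
    intro n f hf
    obtain ⟨d, hd⟩ := exists_order_eq_nat hf.1
    exact key d _ n f hf hd rfl
  intro d
  induction d using Nat.strong_induction_on with
  | _ d ihd =>
  intro α
  induction α using WellFoundedLT.induction with
  | _ α ihα =>
  intro n f hf hfd hfα
  have hn : n ≠ 0 := by
    rintro rfl
    exact not_isSingular_zero f hf
  -- the common end-game: a singular successor `g` whose slice has order `≤ ord f`, with the `κ`-drop on plateaus
  have close : ∀ (g : MvPowerSeries (Fin (n + 1)) k), CobordantGame.IsSingular k g →
      ¬ (MvPowerSeries.X (0 : Fin (n + 1)) ∣ g) →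
      MvPowerSeries.order (slice0 g) ≤ f.order →
      (MvPowerSeries.order (slice0 g) = f.order → κ n (slice0 g) < κ n f) →
      CobordantGame.Won k (n + 1) g := by
    intro g hg hndvd hle hplateau
    obtain ⟨hgs, hdvd⟩ := stub_sliceOrder k n g
    obtain ⟨d', hd'⟩ := exists_order_eq_nat hg.1
    have hd'le : d' ≤ d := by
      have : (d' : ℕ∞) ≤ d := by
        calc (d' : ℕ∞) = g.order := hd'.symm
          _ ≤ MvPowerSeries.order (slice0 g) := hgs
          _ ≤ f.order := hle
          _ = d := hfd
      exact_mod_cast this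
    rcases Nat.lt_or_ge d' d with hlt | hge
    · exact ihd d' hlt (κ (n + 1) g) (n + 1) g hg hd' rfl
    · have hdd : d' = d := le_antisymm hd'le hge
      subst hdd
      have hslice : MvPowerSeries.order (slice0 g) = f.order := by
        apply le_antisymm hle
        rw [hfd, ← hd']
        exact hgs
      have hgo : g.order = MvPowerSeries.order (slice0 g) := by rw [hslice, hfd, hd']
      have hlt : κ (n + 1) g < α := by
        calc κ (n + 1) g ≤ κ n (slice0 g) := hR n g hg hndvd hgo
          _ < κ n f := hplateau hslice
          _ = α := hfα
      exact ihα _ hlt n.succ g hg hd' rfl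
  rcases hC n f hf with hHom | ⟨θ, w, hθ0, hθdet, hwpos, hgen⟩
  · -- the homothety branch
    refine CobordantGame.Won.move (fun i => MvPowerSeries.X i) (fun _ => 1) (isMove_homothety hn) ?_
    intro g hg
    obtain ⟨c, a, hc, hfac, hndvd, hsing⟩ := hg
    have hgS : CobordantGame.IsSingular k g :=
      CobordantGame.IsSuccessor.isSingular ⟨c, a, hc, hfac, hndvd, hsing⟩
    have hcc : CobordantGame.cruxChart k (fun _ : Fin n => 1) c = CobordantChart.chart (fun _ : Fin n => 1) c := by
      have h := CobordantChart.cruxChart_eq_chart (k := k) (fun _ : Fin n => 1) c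
      simp only [Nat.one_pos, if_true] at h
      exact h
    have hXf : MvPowerSeries.subst (fun i : Fin n => (MvPowerSeries.X i : MvPowerSeries (Fin n) k)) f = f := by
      rw [MvPowerSeries.subst_self]; rfl
    rw [hcc, hXf] at hfac
    have hcne : c ≠ 0 := by
      obtain ⟨i, -, hci⟩ := hc
      intro h; exact hci (by simp [h])
    refine close g hgS hndvd (stub_pointBlowupOrder k n f hf.1 c a g hfac hndvd) ?_
    intro hplat
    exact hHom c hcne a g hfac hndvd hsing (stub_sliceSingular k n g hsing) hplat
  · -- a general move supplied by the stub
    refine CobordantGame.Won.move θ w ⟨hθ0, hθdet, hwpos⟩ ?_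
    intro g hg
    obtain ⟨c, a, hc, hfac, hndvd, hsing⟩ := hg
    have hgS : CobordantGame.IsSingular k g :=
      CobordantGame.IsSuccessor.isSingular ⟨c, a, hc, hfac, hndvd, hsing⟩
    set c' : Fin n → k := fun i => if 0 < w i then c i else 0 with hc'def
    have hconv : ∀ i, w i = 0 → c' i = 0 := by
      intro i hi
      simp [hc'def, hi]
    have hne : c' ≠ 0 := by
      obtain ⟨i, hwi, hci⟩ := hc
      intro h
      have := congrFun h i
      simp [hc'def, hwi] at this
      exact hci this
    have hcc : CobordantGame.cruxChart k w c = CobordantChart.chart w c' :=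
      CobordantChart.cruxChart_eq_chart (k := k) w c
    rw [hcc] at hfac
    obtain ⟨hle, hplateau⟩ := hgen c' hconv hne a g hfac hndvd hsing (stub_sliceSingular k n g hsing)
    exact close g hgS hndvd hle hplateau

end Summit.ResolutionOfSingularities.ResolutionOfSingularities.Theorems.ConeRestrictionLine

#h21_check_skeleton "stmt-ResolutionOfSingularities-8899" Summit.ResolutionOfSingularities.ResolutionOfSingularities.Theses.WeightedInvariant.LocalWeightedDrop stub_sliceOrder stub_sliceSingular stub_pointBlowupOrder stub_coneRestrictionRank
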